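import Summits.BirchSwinnertonDyer.BirchSwinnertonDyer.Theses.SylvesterTwoHeegnerIndex
import Summits.BirchSwinnertonDyer.BirchSwinnertonDyer.Theorems.SylvesterTwoHeegnerIndexFirstLayerSplit
import Summits.BirchSwinnertonDyer.BirchSwinnertonDyer.Theorems.SylvesterTwoHeegnerIndexCoupledUpperBoundReductionSeven
import Summits.BirchSwinnertonDyer.BirchSwinnertonDyer.Theorems.SylvesterTwoHeegnerIndexCoupledDescentFirstLayerOfLayerL1
import Summits.BirchSwinnertonDyer.BirchSwinnertonDyer.Theorems.SylvesterTwoHeegnerIndexCMFlipLayerL1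
import Summits.BirchSwinnertonDyer.BirchSwinnertonDyer.Theorems.SylvesterTwoHeegnerIndexCMHalfInvolutionFixingBottomOfLevel
import Summits.BirchSwinnertonDyer.BirchSwinnertonDyer.Theorems.SylvesterTwoHeegnerIndexCoupledTelescopeTailFourOfResidue
import Summits.BirchSwinnertonDyer.BirchSwinnertonDyer.Theorems.SylvesterTwoHeegnerIndexCoupledTelescopeTailSevenOfResidue
import Summits.BirchSwinnertonDyer.BirchSwinnertonDyer.Theorems.SylvesterTwoHeegnerIndexCoupledTelescopeConeDischarge
import Literature.NumberTheory.EllipticCurves.CasselsTateCanonicalAdjoint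

/-! # Skeleton VARIANT O for crux `UpperOffV0HSYPlus` (stmt-BirchSwinnertonDyer-19804) —
«VARIANT N WITH THE TAIL'S PRINT INPUT NAMED AND THE ROWS' CONTRACT AS THE STUBS» (planner bsd-cm-plan g31,
2026-08-29, D679/D681; director-bsd RESTUB SHAPE OF RECORD HOME/INBOX.md l.236: per print-touched stub ONE token —
`stub_tailFour` / `stub_tailSeven` were MIXED → `stub_residueFour` / `stub_residueSeven`).

WHAT CHANGED vs VARIANT N `Lines/coupled_variantN.lean` f1e6457dcfac7751 (which stays published as the prior reading).
VARIANT N's two TAIL stubs `stub_tailFour` / `stub_tailSeven` were each ONE printed pairing input + ONE rows' contract: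
seat bsd-cm-k7t-c2 g28's CONDITIONAL tree theorems `SylvesterTwoCoupledTelescope.tailFour_of_residue hvii hH3 hLP hR`
(p714972) / `tailSeven_of_residue …` (p714989) conclude them VERBATIM from (i) `hvii` = clause (vii) of the Literature
named fact `casselsTate_canonical_adjoint K σ₀ h2 hσ₀` (its SECOND conjunct, verbatim; Fisher 2003 Prop. 2.16 / Milne ADT
I §6 — the res/cor adjunction of the Cassels–Tate pairing of the canonical local invariants, for every quadratic `K`;
planner D636), (ii) `hH3` / `hLP` = the cone's `Ш³(F, μ_n) = 0` and level property, DISCHARGED in the tree by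
`SylvesterTwoCoupledTelescope.H3_holds` / `LP_holds` (`…CoupledTelescopeConeDischarge`, p715484), and (iii) `hR` = the
ROWS' CONTRACT «RESIDUE 4 v3» / «RESIDUE 7 v3» (HOME `bsd-cm-k7t-c2/g28/RESIDUE-4.v3.display.txt` 8857513de2233188 and its
7-twin = the `hR` binders of the two theorems, l.111–305 of either file): (T-L5) provenance, then for every level
`κ ≥ max(M₀,1)`, every pinned one-φ datum and Weil datum — the level's Kolyvagin primes, admissible sets, bottom class,
(T-L1) flips, (T-L2)′ local leaves in 𝒪-line form, the (T-L3) mixed Čebotarev clause (kernel form), and the `ℚ`-Kummer five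
per curve (planner readings D646/D665/D670 (1)).
HERE: the print input becomes the CITE stub `stub_printInputVII` (the named fact for every quadratic `K`; never a prover
target — it closes by typing Milne/Fisher in `Literature`), the two contracts become the research stubs `stub_residueFour` /
`stub_residueSeven` (the `hR` binder texts VERBATIM, re-indented only), and VARIANT N's `stub_tailFour` / `stub_tailSeven`
statements are CLOSED IN-FILE as `tailFour_closed` / `tailSeven_closed` (types VERBATIM) by the booked terms
`tailFour_of_residue (fun K _ _ σ₀ h2 hσ₀ ↦ (stub_printInputVII K σ₀ h2 hσ₀).2) H3_holds LP_holds stub_residueFour` /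
`tailSeven_of_residue …`.  `stub_printInputsTwo`, `stub_levelFixingSeven`, `layerL1Four_closed`, `thmC_closed`,
`layerL1Seven_closed`, `firstLayerFour_closed`, `firstLayerSeven_closed` are VARIANT N's BYTE-IDENTICAL; the composition
`UpperOffV0HSYPlus_of` is VARIANT N's with `tailFour_closed` / `tailSeven_closed` in place of the old stubs.
Registered stubs (FIVE): `stub_printInputsTwo` (PURE-CITE), `stub_printInputVII` (PURE-CITE), `stub_levelFixingSeven`
(CONTENT: research (W2-b), row k-p1 / item 19802; bench 2026-08-29 «research content, not misstated»), `stub_residueFour`,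
`stub_residueSeven` (CONTENT: the rows' contracts, row k-p2; their leaves are being closed in-cell BY COMPOSITION —
k-ty1 #35–#38 (`SelmerTorsionOperatorLocalKernel`, `JZeroTwoPowerTorsionGaloisLine`, `…MovingElement`, `…Kummer`,
`…KummerPair` ★ KD² `JZero.exists_h1Eval_pair_two_pow`), k7t-c2 (XX) `kummerFive_of_generator_transport` /
`kummerFive_of_torsion_transport` (p719600), (O1) `kernelForm_closure_pair_iff` (KernelForm), the pair Čebotarev
`exists_kolyvaginPrime_gt_of_galoisElement_pair (M := 2κ)`, `HeegnerPointsKolyvaginPairingCMConj` — no text of the contract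
changes when a leaf lands).
READING OF RECORD after this file: CRUX `UpperOffV0HSYPlus` ⟸ PRINT {deg-6 `Dt`, #19, #20, VII} ∪ RESEARCH {(W2-b)} ∪
ROWS {RESIDUE 4 v3, RESIDUE 7 v3}; nothing else.
DEGENERATE-WITNESS / VACUITY PASS (planner D681): `stub_printInputVII` is a `∀ K σ₀ h2 hσ₀` over a cite-tagged `def … : Prop`
(unproved in the tree — named-fact debt of record, load-bearing since D636; it is NOT junk-true: both conjuncts quantify over
genuine Weil data `e` with `hnd` non-degeneracy, instantiated in-tree by the curve package p712464); `stub_residueFour/Seven`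
inherit VARIANT M's DEGENERATE-MEMBER pass for the row binders (the guard `4 < #Ш[2^∞](B)·#Ш[2^∞](A)` excludes the empty
product; `qB * qA ≠ 0`; `K` genuinely quadratic with `ω`) and their conclusion is an `∃ M₀ x₀ T, …` whose level clause
quantifies over EVERY `κ ≥ max(M₀,1)` and every pinned datum — exactly what `tailFour_of_residue` consumes (its proof
instantiates `κ` above the four exponents, l.330–340), so no weaker reading would close the tail; VARIANT N's pass for the
other stubs carries over verbatim.  Nothing is asserted; no stub is closed on the ledger by this file; items 19802/19804
OPEN; X12.CMAtTwo NOT proved; BSD is not claimed for any curve. -/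

set_option linter.dupNamespace false
set_option autoImplicit false

open scoped Classical Pointwise
open WeierstrassCurve Field NumberField IsDedekindDomain IsDedekindDomain.HeightOneSpectrum
open Literature.NumberTheory.EllipticCurves Literature.NumberTheory.GaloisRepresentations
  Literature.NumberTheory.EllipticCurves.ModularForms
  Literature.NumberTheory.EllipticCurves.HuShuYin2019
  Literature.NumberTheory.EllipticCurves.KolyvaginCocycle
  Literature.NumberTheory.EllipticCurves.RingClassField

namespace Summit.BirchSwinnertonDyer.BirchSwinnertonDyer.Cruxes.UpperOffV0HSYPlus.CoupledVariantO

open Summit.BirchSwinnertonDyer.BirchSwinnertonDyer.Theses.SylvesterTwoHeegnerIndex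
open Summit.BirchSwinnertonDyer.BirchSwinnertonDyer.Theorems
open Summit.BirchSwinnertonDyer.BirchSwinnertonDyer.Theorems.SylvesterTwoCoupledUpperBound
open Summit.BirchSwinnertonDyer.BirchSwinnertonDyer.Theorems.SylvesterTwoFirstLayerSplit
open Summit.BirchSwinnertonDyer.BirchSwinnertonDyer.Theorems.SylvesterTwoCoupledDescentCebotarev
open Summit.BirchSwinnertonDyer.Rank1Residual.X11b Summit.BirchSwinnertonDyer.Rank1Residual.X11b.RingClassTower
open Summit.BirchSwinnertonDyer.BirchSwinnertonDyer.Theorems.SylvesterTwoCoupledTelescope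
open Literature.NumberTheory.GaloisCohomology Literature.GroupTheory.FiniteAbelian
  Literature.NumberTheory.EllipticCurves.KolyvaginDescent
open Literature.NumberTheory.GaloisRepresentations.DiscreteGaloisModule (mu)
open scoped AddSubgroup

/-- **PRINT stub — the three displayed print inputs of the LAYER/THEOREM-C side BY NAME** (never a prover target here;
= the contents of planner ask #1 (ρ2′) `PublishedInputsKolyvaginTwo`): a degree-6 modular parametrisation of `243b`,
HSY's named height display #19, Nekovář's congruence (ES2) #20.
[cite: HuShuYin2019, Thm. 1.4, Cor. 4.4, display (bsd) p. 12] [cite: Nekovar2007, Prop. 4.9] -/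
theorem stub_printInputsTwo :
    (∃ Dt : ModularParametrizationData (⟨0, 0, 1, 0, -1⟩ : WeierstrassCurve ℚ) 243, Dt.deg = 6) ∧
      shaAnPair_mul_height_eq_two_zpow_mul_height_named ∧ Nekovar2007.cmPoint_frobeniusCongruence := by
  sorry

/-- **PRINT stub — the TAIL's one printed pairing input BY NAME** (never a prover target here): the Literature named
fact `casselsTate_canonical_adjoint` (isogeny adjunction + res/cor adjunction of the Cassels–Tate pairing of the
canonical local invariants) for every quadratic field `K`; its second conjunct is the `hvii` binder of
`tailFour_of_residue` / `tailSeven_of_residue` VERBATIM (planner D636).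
[cite: Fisher2003, Prop. 2.16 (JNT 98, p. 132)] [cite: MilneADT2006, Ch. I §6 Rem. 6.10(a) (p. 87), Prop. 6.9, Thm. 6.13(a)] -/
theorem stub_printInputVII :
    ∀ (K : Type) [Field K] [NumberField K] (σ₀ : K ≃ₐ[ℚ] K) (h2 : Module.finrank ℚ K = 2) (hσ₀ : σ₀ ≠ 1),
      casselsTate_canonical_adjoint K σ₀ h2 hσ₀ := by
  sorry

set_option maxHeartbeats 1600000 in
/-- **stub (research; row k-p1 / item 19802) — (W2-b) THE LEVEL INVOLUTION AT `w ∣ 3` FIXES THE HEEGNER POINT OF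
CONDUCTOR `9pn`, `p ≡ 7 (mod 9)`** (the `hW2b` binder of `SylvesterTwoCMHalf.thmC_of_named_of_levelInvolutionFixing` /
`…layerL1Seven_of_named_of_flip_of_levelInvolutionFixing` VERBATIM, for every degree-6 `Dt`; memo two §67.2, desk
(M-K3-7); planner D552 node (ρ3)). [size M–L] [cite: GrossLMS1991, §3–§6] [cite: HuShuYin2019, §4.1 p. 10] -/
theorem stub_levelFixingSeven :
    ∀ (Dt : ModularParametrizationData (⟨0, 0, 1, 0, -1⟩ : WeierstrassCurve ℚ) 243), Dt.deg = 6 →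
      ∀ (p : ℕ), p.Prime → p % 9 = 7 → ∀ (K : Type) [Field K] [NumberField K] (ω : K), ω ^ 2 + ω + 1 = 0 →
      Module.finrank ℚ K = 2 → ∀ (ι : K →+* ℂ) (v : HeightOneSpectrum (𝓞 K)), ((3 : ℕ) : 𝓞 K) ∈ v.asIdeal →
      ∀ (n : ℕ), n ≠ 0 → (∀ q ∈ n.primeFactors, q % 3 = 2) →
      ∀ (e : ringClassField K ι (9 * p * n) →+* AlgebraicClosure K),
      (∀ k : K, e (algebraMap K (ringClassField K ι (9 * p * n)) k) = algebraMap K (AlgebraicClosure K) k) →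
      ∀ (y : ((⟨0, 0, 1, 0, -1⟩ : WeierstrassCurve ℚ).baseChange (ringClassField K ι (9 * p * n))).toAffine.Point),
      Affine.Point.map (W' := (⟨0, 0, 1, 0, -1⟩ : WeierstrassCurve ℚ)) (ringClassField K ι (9 * p * n)).subtype.toRatAlgHom y =
      Dt.φ (heegnerTau ((n : ℤ) ^ 2 * (81 * ((p : ℤ) ^ 2 + 4 * p + 16)),
      (n : ℤ) * (-(9 * (4 * (p : ℤ) ^ 2 + 17 * p + 72))), 4 * (p : ℤ) ^ 2 + 18 * p + 81)) →
      ∀ (τ : absoluteGaloisGroup (v.adicCompletion K))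
      (φ : ringClassField K ι (9 * p * n) ≃ₐ[K] ringClassField K ι (9 * p * n)),
      (∀ x : ringClassField K ι (9 * p * n), (show AlgebraicClosure K ≃ₐ[K] AlgebraicClosure K from
      resGal (K := K) (v.adicCompletion K) τ) (e x) = e (φ x)) → φ * φ = 1 →
      pointGalHom (⟨0, 0, 1, 0, -1⟩ : WeierstrassCurve ℚ) (ringClassField K ι (9 * p * n)) (φ.restrictScalars ℚ) y = y := by
  sorry

set_option maxHeartbeats 1600000 in
/-- **CLOSED BY NAME — VARIANT M's `stub_layerL1Four` VERBATIM** from `stub_printInputsTwo` through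
`SylvesterTwoCMFlip.layerL1Four_of_named_of_flip` (p677294). No `sorry` here. -/
theorem layerL1Four_closed : PublishedFactsTwoPlus →
      ∀ (p : ℕ), p.Prime → p % 9 = 4 → (¬ ∃ x : ZMod p, x ^ 3 = 3) →
        ∀ (A B : WeierstrassCurve ℚ) [A.IsElliptic] [A.IsGloballyMinimal] [B.IsElliptic]
          [B.IsGloballyMinimal], (∃ C : VariableChange ℚ, C • B = HuShuYin2019.cubeSumCurve (p : ℚ)) →
          (∃ C : VariableChange ℚ, C • A = HuShuYin2019.cubeSumCurve (3 * (p : ℚ) ^ 2)) →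
          ∀ (qB qA : ℚ), shaAn B = (qB : ℂ) → shaAn A = (qA : ℂ) → qB * qA ≠ 0 →
            padicValRat 2 (qB * qA) = 0 →
            ∀ (K : Type) [Field K] [NumberField K] (ω : K), ω ^ 2 + ω + 1 = 0 →
              Module.finrank ℚ K = 2 →
            ∀ Y₀ : ((cubeSumCurve (p : ℚ)).baseChange K).toAffine.Point,
              (¬ ∃ Q : ((cubeSumCurve (p : ℚ)).baseChange K).toAffine.Point, (2 : ℕ) • Q = Y₀) →
            ∃ (cA : ℕ → galH1Torsion ((cubeSumCurve (3 * (p : ℚ) ^ 2)).baseChange K) (2 : ℕ))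
              (cB : ℕ → galH1Torsion ((cubeSumCurve (p : ℚ)).baseChange K) (2 : ℕ)),
            (∀ ℓ, (ℓ.Prime ∧ ¬ ℓ ∣ (cubeSumCurve (3 * (p : ℚ) ^ 2)).conductorNorm ℤ ∧
                ¬ ℓ ∣ (cubeSumCurve (p : ℚ)).conductorNorm ℤ ∧ ¬ ((ℓ : ℤ) ∣ NumberField.discr K) ∧ ℓ ≠ 2 ∧
                (Ideal.span {(ℓ : 𝓞 K)}).IsPrime ∧
                FrobEqFrobInfty (cubeSumCurve (3 * (p : ℚ) ^ 2)) K 2 ℓ ∧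
                FrobEqFrobInfty (cubeSumCurve (p : ℚ)) K 2 ℓ) →
              (∀ v : HeightOneSpectrum (𝓞 K), (ℓ : 𝓞 K) ∉ v.asIdeal →
                cA ℓ ∈ selmerLocalKer ((cubeSumCurve (3 * (p : ℚ) ^ 2)).baseChange K)
                  (v.adicCompletion K) (2 : ℕ)) ∧
              (∀ x : InfinitePlace K, cA ℓ ∈ selmerLocalKer
                ((cubeSumCurve (3 * (p : ℚ) ^ 2)).baseChange K) x.Completion (2 : ℕ)) ∧
              (∀ v : HeightOneSpectrum (𝓞 K), (ℓ : 𝓞 K) ∈ v.asIdeal →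
                (cA ℓ ∈ selmerLocalKer ((cubeSumCurve (3 * (p : ℚ) ^ 2)).baseChange K)
                    (v.adicCompletion K) (2 : ℕ) ↔
                  kummerClassOfPoint (cubeSumCurve (p : ℚ)) K Nat.prime_two Y₀ ∈
                    ((cubeSumCurve (p : ℚ)).baseChange K).torsionLocalKer (v.adicCompletion K) (2 : ℕ)))) ∧
            (∀ ℓ ℓ', (ℓ.Prime ∧ ¬ ℓ ∣ (cubeSumCurve (3 * (p : ℚ) ^ 2)).conductorNorm ℤ ∧
                ¬ ℓ ∣ (cubeSumCurve (p : ℚ)).conductorNorm ℤ ∧ ¬ ((ℓ : ℤ) ∣ NumberField.discr K) ∧ ℓ ≠ 2 ∧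
                (Ideal.span {(ℓ : 𝓞 K)}).IsPrime ∧
                FrobEqFrobInfty (cubeSumCurve (3 * (p : ℚ) ^ 2)) K 2 ℓ ∧
                FrobEqFrobInfty (cubeSumCurve (p : ℚ)) K 2 ℓ) →
              (ℓ'.Prime ∧ ¬ ℓ' ∣ (cubeSumCurve (3 * (p : ℚ) ^ 2)).conductorNorm ℤ ∧
                ¬ ℓ' ∣ (cubeSumCurve (p : ℚ)).conductorNorm ℤ ∧ ¬ ((ℓ' : ℤ) ∣ NumberField.discr K) ∧
                ℓ' ≠ 2 ∧ (Ideal.span {(ℓ' : 𝓞 K)}).IsPrime ∧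
                FrobEqFrobInfty (cubeSumCurve (3 * (p : ℚ) ^ 2)) K 2 ℓ' ∧
                FrobEqFrobInfty (cubeSumCurve (p : ℚ)) K 2 ℓ') → ℓ ≠ ℓ' →
              (∀ v : HeightOneSpectrum (𝓞 K), (ℓ : 𝓞 K) ∉ v.asIdeal → (ℓ' : 𝓞 K) ∉ v.asIdeal →
                cB (ℓ * ℓ') ∈ selmerLocalKer ((cubeSumCurve (p : ℚ)).baseChange K)
                  (v.adicCompletion K) (2 : ℕ)) ∧
              (∀ x : InfinitePlace K,
                cB (ℓ * ℓ') ∈ selmerLocalKer ((cubeSumCurve (p : ℚ)).baseChange K) x.Completion (2 : ℕ)) ∧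
              (∀ v : HeightOneSpectrum (𝓞 K), (ℓ : 𝓞 K) ∈ v.asIdeal →
                (cB (ℓ * ℓ') ∈ selmerLocalKer ((cubeSumCurve (p : ℚ)).baseChange K)
                    (v.adicCompletion K) (2 : ℕ) ↔
                  cA ℓ' ∈ ((cubeSumCurve (3 * (p : ℚ) ^ 2)).baseChange K).torsionLocalKer
                    (v.adicCompletion K) (2 : ℕ)))) := by
  obtain ⟨⟨Dt, hdeg⟩, hD, hES2⟩ := stub_printInputsTwo
  exact SylvesterTwoCMFlip.layerL1Four_of_named_of_flip Dt hdeg hD hES2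

set_option maxHeartbeats 1600000 in
/-- **CLOSED BY NAME — VARIANT M's `stub_thmC` VERBATIM** (THEOREM C, item 19802) from `stub_printInputsTwo` +
`stub_levelFixingSeven` through `SylvesterTwoCMHalf.thmC_of_named_of_levelInvolutionFixing`. No `sorry` here. -/
theorem thmC_closed : PublishedFactsTwoPlus → SylvesterTwoNonneg.HSYPointTwoDivisibleSevenModNine := by
  obtain ⟨⟨Dt, hdeg⟩, hD, -⟩ := stub_printInputsTwo
  exact SylvesterTwoCMHalf.thmC_of_named_of_levelInvolutionFixing Dt hdeg hD (stub_levelFixingSeven Dt hdeg)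

set_option maxHeartbeats 1600000 in
/-- **CLOSED BY NAME — VARIANT M's `stub_layerL1Seven` VERBATIM** from `stub_printInputsTwo` + `stub_levelFixingSeven`
through `SylvesterTwoCMHalf.layerL1Seven_of_named_of_flip_of_levelInvolutionFixing`. No `sorry` here. -/
theorem layerL1Seven_closed : SylvesterTwoNonneg.HSYPointTwoDivisibleSevenModNine →
    (PublishedFactsTwoPlus →
      ∀ (p : ℕ), p.Prime → p % 9 = 7 → (¬ ∃ x : ZMod p, x ^ 3 = 3) →
        ∀ (A B : WeierstrassCurve ℚ) [A.IsElliptic] [A.IsGloballyMinimal] [B.IsElliptic]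
          [B.IsGloballyMinimal], (∃ C : VariableChange ℚ, C • B = HuShuYin2019.cubeSumCurve (p : ℚ)) →
          (∃ C : VariableChange ℚ, C • A = HuShuYin2019.cubeSumCurve (3 * (p : ℚ) ^ 2)) →
          ∀ (qB qA : ℚ), shaAn B = (qB : ℂ) → shaAn A = (qA : ℂ) → qB * qA ≠ 0 →
            padicValRat 2 (qB * qA) = 0 →
            ∀ (K : Type) [Field K] [NumberField K] (ω : K), ω ^ 2 + ω + 1 = 0 →
              Module.finrank ℚ K = 2 →
            ∀ Y₀ : ((cubeSumCurve (p : ℚ)).baseChange K).toAffine.Point,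
              (¬ ∃ Q : ((cubeSumCurve (p : ℚ)).baseChange K).toAffine.Point, (2 : ℕ) • Q = Y₀) →
            ∃ (cA : ℕ → galH1Torsion ((cubeSumCurve (3 * (p : ℚ) ^ 2)).baseChange K) (2 : ℕ))
              (cB : ℕ → galH1Torsion ((cubeSumCurve (p : ℚ)).baseChange K) (2 : ℕ)),
            (∀ ℓ, (ℓ.Prime ∧ ¬ ℓ ∣ (cubeSumCurve (3 * (p : ℚ) ^ 2)).conductorNorm ℤ ∧
                ¬ ℓ ∣ (cubeSumCurve (p : ℚ)).conductorNorm ℤ ∧ ¬ ((ℓ : ℤ) ∣ NumberField.discr K) ∧ ℓ ≠ 2 ∧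
                (Ideal.span {(ℓ : 𝓞 K)}).IsPrime ∧
                FrobEqFrobInfty (cubeSumCurve (3 * (p : ℚ) ^ 2)) K 2 ℓ ∧
                FrobEqFrobInfty (cubeSumCurve (p : ℚ)) K 2 ℓ) →
              (∀ v : HeightOneSpectrum (𝓞 K), (ℓ : 𝓞 K) ∉ v.asIdeal →
                cA ℓ ∈ selmerLocalKer ((cubeSumCurve (3 * (p : ℚ) ^ 2)).baseChange K)
                  (v.adicCompletion K) (2 : ℕ)) ∧
              (∀ x : InfinitePlace K, cA ℓ ∈ selmerLocalKer
                ((cubeSumCurve (3 * (p : ℚ) ^ 2)).baseChange K) x.Completion (2 : ℕ)) ∧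
              (∀ v : HeightOneSpectrum (𝓞 K), (ℓ : 𝓞 K) ∈ v.asIdeal →
                (cA ℓ ∈ selmerLocalKer ((cubeSumCurve (3 * (p : ℚ) ^ 2)).baseChange K)
                    (v.adicCompletion K) (2 : ℕ) ↔
                  kummerClassOfPoint (cubeSumCurve (p : ℚ)) K Nat.prime_two Y₀ ∈
                    ((cubeSumCurve (p : ℚ)).baseChange K).torsionLocalKer (v.adicCompletion K) (2 : ℕ)))) ∧
            (∀ ℓ ℓ', (ℓ.Prime ∧ ¬ ℓ ∣ (cubeSumCurve (3 * (p : ℚ) ^ 2)).conductorNorm ℤ ∧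
                ¬ ℓ ∣ (cubeSumCurve (p : ℚ)).conductorNorm ℤ ∧ ¬ ((ℓ : ℤ) ∣ NumberField.discr K) ∧ ℓ ≠ 2 ∧
                (Ideal.span {(ℓ : 𝓞 K)}).IsPrime ∧
                FrobEqFrobInfty (cubeSumCurve (3 * (p : ℚ) ^ 2)) K 2 ℓ ∧
                FrobEqFrobInfty (cubeSumCurve (p : ℚ)) K 2 ℓ) →
              (ℓ'.Prime ∧ ¬ ℓ' ∣ (cubeSumCurve (3 * (p : ℚ) ^ 2)).conductorNorm ℤ ∧
                ¬ ℓ' ∣ (cubeSumCurve (p : ℚ)).conductorNorm ℤ ∧ ¬ ((ℓ' : ℤ) ∣ NumberField.discr K) ∧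
                ℓ' ≠ 2 ∧ (Ideal.span {(ℓ' : 𝓞 K)}).IsPrime ∧
                FrobEqFrobInfty (cubeSumCurve (3 * (p : ℚ) ^ 2)) K 2 ℓ' ∧
                FrobEqFrobInfty (cubeSumCurve (p : ℚ)) K 2 ℓ') → ℓ ≠ ℓ' →
              (∀ v : HeightOneSpectrum (𝓞 K), (ℓ : 𝓞 K) ∉ v.asIdeal → (ℓ' : 𝓞 K) ∉ v.asIdeal →
                cB (ℓ * ℓ') ∈ selmerLocalKer ((cubeSumCurve (p : ℚ)).baseChange K)
                  (v.adicCompletion K) (2 : ℕ)) ∧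
              (∀ x : InfinitePlace K,
                cB (ℓ * ℓ') ∈ selmerLocalKer ((cubeSumCurve (p : ℚ)).baseChange K) x.Completion (2 : ℕ)) ∧
              (∀ v : HeightOneSpectrum (𝓞 K), (ℓ : 𝓞 K) ∈ v.asIdeal →
                (cB (ℓ * ℓ') ∈ selmerLocalKer ((cubeSumCurve (p : ℚ)).baseChange K)
                    (v.adicCompletion K) (2 : ℕ) ↔
                  cA ℓ' ∈ ((cubeSumCurve (3 * (p : ℚ) ^ 2)).baseChange K).torsionLocalKer
                    (v.adicCompletion K) (2 : ℕ))))) := by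
  obtain ⟨⟨Dt, hdeg⟩, hD, hES2⟩ := stub_printInputsTwo
  exact SylvesterTwoCMHalf.layerL1Seven_of_named_of_flip_of_levelInvolutionFixing Dt hdeg hD hES2
    (stub_levelFixingSeven Dt hdeg)

set_option maxHeartbeats 1600000 in
/-- **CLOSED — FIRST LAYER, p ≡ 4 (9)** (VARIANT M's `firstLayerFour_closed` VERBATIM, from `layerL1Four_closed` by
g22 #22 `firstLayerFour_of_layerL1`). -/
theorem firstLayerFour_closed : PublishedFactsTwoPlus →
    ∀ (p : ℕ), p.Prime → p % 9 = 4 → (¬ ∃ x : ZMod p, x ^ 3 = 3) →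
      ∀ (A B : WeierstrassCurve ℚ) [A.IsElliptic] [A.IsGloballyMinimal] [B.IsElliptic]
        [B.IsGloballyMinimal], (∃ C : VariableChange ℚ, C • B = HuShuYin2019.cubeSumCurve (p : ℚ)) →
        (∃ C : VariableChange ℚ, C • A = HuShuYin2019.cubeSumCurve (3 * (p : ℚ) ^ 2)) →
        ∀ (qB qA : ℚ), shaAn B = (qB : ℂ) → shaAn A = (qA : ℂ) → qB * qA ≠ 0 →
          padicValRat 2 (qB * qA) = 0 →
          Nat.card (AddCommGroup.primaryComponent B.sha 2) = 1 ∧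
            Nat.card (AddCommGroup.primaryComponent A.sha 2) = 1 :=
  firstLayerFour_of_layerL1 layerL1Four_closed

set_option maxHeartbeats 1600000 in
/-- **stub (row k-p2, p ≡ 4 (9)) — RESIDUE 4 v3: THE ROWS' CONTRACT** (the `hR` binder of
`SylvesterTwoCoupledTelescope.tailFour_of_residue` VERBATIM, p714972; display `RESIDUE-4.v3.display.txt` 8857513de2233188).
Its leaves are closed in-cell by composition (k-ty1 #35–#38, k7t-c2 (XX)/(O1), pair Čebotarev, CMConj); the contract's
text does not change when a leaf lands. [size XL] [cite: McCallumLMS1991, §4–§5, Thm. 5.4, Cor. 5.6] [cite: GrossLMS1991, §3–§5] -/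
theorem stub_residueFour :
    PublishedFactsTwoPlus →
    ∀ (p : ℕ), p.Prime → p % 9 = 4 → (¬ ∃ x : ZMod p, x ^ 3 = 3) →
      ∀ (A B : WeierstrassCurve ℚ) [A.IsElliptic] [A.IsGloballyMinimal] [B.IsElliptic]
        [B.IsGloballyMinimal], (∃ C : VariableChange ℚ, C • B = HuShuYin2019.cubeSumCurve (p : ℚ)) →
        (∃ C : VariableChange ℚ, C • A = HuShuYin2019.cubeSumCurve (3 * (p : ℚ) ^ 2)) →
        4 < Nat.card (AddCommGroup.primaryComponent B.sha 2) *
            Nat.card (AddCommGroup.primaryComponent A.sha 2) →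
        ∀ (qB qA : ℚ), shaAn B = (qB : ℂ) → shaAn A = (qA : ℂ) → qB * qA ≠ 0 →
        ∀ (K : Type) [Field K] [NumberField K] (ω : K), ω ^ 2 + ω + 1 = 0 →
          Module.finrank ℚ K = 2 →
        ∀ (CB : VariableChange ℚ) (hCB : CB • B = HuShuYin2019.cubeSumCurve (p : ℚ))
          (P : B.toAffine.Point) (Y : (B.baseChange K).toAffine.Point),
          ¬ IsOfFinAddOrder (WeierstrassCurve.QuadraticDescent.incl K B P) →
          (∀ Q : B.toAffine.Point, ∃ m : ℤ, IsOfFinAddOrder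
            (WeierstrassCurve.QuadraticDescent.incl K B Q -
              m • WeierstrassCurve.QuadraticDescent.incl K B P)) →
          ((qB * qA : ℚ) : ℝ) *
              WeierstrassCurve.Affine.Point.canonicalHeight (WeierstrassCurve.QuadraticDescent.incl K B P) =
            (2 : ℝ) ^ (if p % 9 = 4 then (0 : ℤ) else -2) *
              WeierstrassCurve.Affine.Point.canonicalHeight Y →
        -- THE RESIDUE: provenance, then for every level `κ ≥ max(M₀, 1)`, every pinned one-φ datum
        -- and every Weil datum, the rows' level-`κ` leaves
        ∃ (M₀ : ℕ) (x₀ T : ((cubeSumCurve (p : ℚ)).baseChange K).toAffine.Point),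
        IsOfFinAddOrder T ∧
        Affine.Point.congrEquiv (congrArg (fun W : WeierstrassCurve ℚ ↦ W.baseChange K) hCB)
            (VariableChange.pointEquivBaseChange B CB K Y) = ((2 ^ M₀ : ℕ) : ℤ) • x₀ + T ∧
        2 * (M₀ : ℤ) ≤ padicValRat 2 (qB * qA) ∧
        ∀ κ : ℕ, M₀ ≤ κ → 1 ≤ κ →
        ∀ (φA : Isogeny ((cubeSumCurve (3 * (p : ℚ) ^ 2)).baseChange K) ((cubeSumCurve (3 * (p : ℚ) ^ 2)).baseChange K))
          (fnA : geomTorsion ((cubeSumCurve (3 * (p : ℚ) ^ 2)).baseChange K) ((2 ^ κ * 2 ^ κ : ℕ) : ℤ) →+ geomTorsion ((cubeSumCurve (3 * (p : ℚ) ^ 2)).baseChange K) ((2 ^ κ * 2 ^ κ : ℕ) : ℤ))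
          (hfnA : ∀ (g : absoluteGaloisGroup K) (Q : geomTorsion ((cubeSumCurve (3 * (p : ℚ) ^ 2)).baseChange K) ((2 ^ κ * 2 ^ κ : ℕ) : ℤ)),
            fnA (ContinuousMonoidHom.id _ g • Q) = g • fnA Q),
          (∀ (x y : AlgebraicClosure K)
            (h : (((cubeSumCurve (3 * (p : ℚ) ^ 2)).baseChange K).baseChange (AlgebraicClosure K)).toAffine.Nonsingular x y),
            ∃ h', φA (Affine.Point.some x y h) =
              Affine.Point.some (algebraMap K (AlgebraicClosure K) ω ^ 2 * x)
                (algebraMap K (AlgebraicClosure K) ω ^ 3 * y) h') →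
          (∀ Q : geomTorsion ((cubeSumCurve (3 * (p : ℚ) ^ 2)).baseChange K) ((2 ^ κ * 2 ^ κ : ℕ) : ℤ),
            ((fnA Q : geomTorsion ((cubeSumCurve (3 * (p : ℚ) ^ 2)).baseChange K) ((2 ^ κ * 2 ^ κ : ℕ) : ℤ)) : geomPoints ((cubeSumCurve (3 * (p : ℚ) ^ 2)).baseChange K)) = φA Q) →
        ∀ (φB : Isogeny ((cubeSumCurve (p : ℚ)).baseChange K) ((cubeSumCurve (p : ℚ)).baseChange K))
          (fnB : geomTorsion ((cubeSumCurve (p : ℚ)).baseChange K) ((2 ^ κ * 2 ^ κ : ℕ) : ℤ) →+ geomTorsion ((cubeSumCurve (p : ℚ)).baseChange K) ((2 ^ κ * 2 ^ κ : ℕ) : ℤ))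
          (hfnB : ∀ (g : absoluteGaloisGroup K) (Q : geomTorsion ((cubeSumCurve (p : ℚ)).baseChange K) ((2 ^ κ * 2 ^ κ : ℕ) : ℤ)),
            fnB (ContinuousMonoidHom.id _ g • Q) = g • fnB Q),
          (∀ (x y : AlgebraicClosure K)
            (h : (((cubeSumCurve (p : ℚ)).baseChange K).baseChange (AlgebraicClosure K)).toAffine.Nonsingular x y),
            ∃ h', φB (Affine.Point.some x y h) =
              Affine.Point.some (algebraMap K (AlgebraicClosure K) ω ^ 2 * x)
                (algebraMap K (AlgebraicClosure K) ω ^ 3 * y) h') →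
          (∀ Q : geomTorsion ((cubeSumCurve (p : ℚ)).baseChange K) ((2 ^ κ * 2 ^ κ : ℕ) : ℤ),
            ((fnB Q : geomTorsion ((cubeSumCurve (p : ℚ)).baseChange K) ((2 ^ κ * 2 ^ κ : ℕ) : ℤ)) : geomPoints ((cubeSumCurve (p : ℚ)).baseChange K)) = φB Q) →
        ∀ (eA : geomTorsion ((cubeSumCurve (3 * (p : ℚ) ^ 2)).baseChange K) ((2 ^ κ * 2 ^ κ : ℕ) : ℤ) → geomTorsion ((cubeSumCurve (3 * (p : ℚ) ^ 2)).baseChange K) ((2 ^ κ * 2 ^ κ : ℕ) : ℤ) → AlgebraicClosure K)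
          (hμA : ∀ S T, eA S T ^ (2 ^ κ * 2 ^ κ) = 1)
          (hadd₁A : ∀ S₁ S₂ T, eA (S₁ + S₂) T = eA S₁ T * eA S₂ T)
          (hadd₂A : ∀ S T₁ T₂, eA S (T₁ + T₂) = eA S T₁ * eA S T₂)
          (hgalA : ∀ (σ : absoluteGaloisGroup K) (S T : geomTorsion ((cubeSumCurve (3 * (p : ℚ) ^ 2)).baseChange K) ((2 ^ κ * 2 ^ κ : ℕ) : ℤ)),
            σ • eA S T = eA (σ • S) (σ • T)),
          (∀ T, eA T T = 1) → (∀ T, (∀ S, eA S T = 1) → T = 0) →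
        ∀ (eB : geomTorsion ((cubeSumCurve (p : ℚ)).baseChange K) ((2 ^ κ * 2 ^ κ : ℕ) : ℤ) → geomTorsion ((cubeSumCurve (p : ℚ)).baseChange K) ((2 ^ κ * 2 ^ κ : ℕ) : ℤ) → AlgebraicClosure K)
          (hμB : ∀ S T, eB S T ^ (2 ^ κ * 2 ^ κ) = 1)
          (hadd₁B : ∀ S₁ S₂ T, eB (S₁ + S₂) T = eB S₁ T * eB S₂ T)
          (hadd₂B : ∀ S T₁ T₂, eB S (T₁ + T₂) = eB S T₁ * eB S T₂)
          (hgalB : ∀ (σ : absoluteGaloisGroup K) (S T : geomTorsion ((cubeSumCurve (p : ℚ)).baseChange K) ((2 ^ κ * 2 ^ κ : ℕ) : ℤ)),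
            σ • eB S T = eB (σ • S) (σ • T)),
          (∀ T, eB T T = 1) → (∀ T, (∀ S, eB S T = 1) → T = 0) →
        ∃ (Kol : ℕ → Prop)
          (AdmA : Set (galH1Torsion ((cubeSumCurve (3 * (p : ℚ) ^ 2)).baseChange K) ((2 ^ κ * 2 ^ κ : ℕ) : ℤ)))
          (AdmB : Set (galH1Torsion ((cubeSumCurve (p : ℚ)).baseChange K) ((2 ^ κ * 2 ^ κ : ℕ) : ℤ)))
          (x : galH1Torsion ((cubeSumCurve (p : ℚ)).baseChange K) ((2 ^ κ * 2 ^ κ : ℕ) : ℤ))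
          (cA : ℕ → galH1Torsion ((cubeSumCurve (3 * (p : ℚ) ^ 2)).baseChange K) ((2 ^ κ * 2 ^ κ : ℕ) : ℤ))
          (cB : ℕ → galH1Torsion ((cubeSumCurve (p : ℚ)).baseChange K) ((2 ^ κ * 2 ^ κ : ℕ) : ℤ))
          (yA : galH1Torsion (cubeSumCurve (3 * (p : ℚ) ^ 2)) ((2 ^ κ * 2 ^ κ : ℕ) : ℤ))
          (yB : galH1Torsion (cubeSumCurve (p : ℚ)) ((2 ^ κ * 2 ^ κ : ℕ) : ℤ)),
          -- the Kolyvagin primes OF THIS LEVEL: rational primes inert in `K`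
          (∀ ℓ, Kol ℓ → ℓ.Prime ∧ (Ideal.span {(ℓ : 𝓞 K)}).IsPrime) ∧
          -- (T-L5) the bottom class `x = δ x₀` of exact order, `c_B 1 = 2^{M₀} x`
          x = kummerMapTorsion ((cubeSumCurve (p : ℚ)).baseChange K) ((2 ^ κ * 2 ^ κ : ℕ) : ℤ)
            (((cubeSumCurve (p : ℚ)).baseChange K).zsmul_geomPoints_surjective_of_charZero
              (Int.natCast_ne_zero.mpr (mul_ne_zero (pow_ne_zero κ two_ne_zero) (pow_ne_zero κ two_ne_zero)))) x₀ ∧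
          ((2 : ℤ) ^ (2 * κ - 1)) • x ≠ 0 ∧ cB 1 = ((2 : ℤ) ^ M₀) • x ∧
          -- admissibility (the rows' ONE set per curve; `0` and the restrictions from `ℚ` belong to it)
          (∀ n, KolSupp Kol n → Odd n.primeFactors.card → cA n ∈ AdmA) ∧
          (∀ n, KolSupp Kol n → Even n.primeFactors.card → cB n ∈ AdmB) ∧
          (0 : galH1Torsion ((cubeSumCurve (3 * (p : ℚ) ^ 2)).baseChange K) ((2 ^ κ * 2 ^ κ : ℕ) : ℤ)) ∈ AdmA ∧ (0 : galH1Torsion ((cubeSumCurve (p : ℚ)).baseChange K) ((2 ^ κ * 2 ^ κ : ℕ) : ℤ)) ∈ AdmB ∧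
          (∀ u ∈ selmerGroup (cubeSumCurve (3 * (p : ℚ) ^ 2)) ((2 ^ κ * 2 ^ κ : ℕ) : ℤ), resTorsion (cubeSumCurve (3 * (p : ℚ) ^ 2)) K ((2 ^ κ * 2 ^ κ : ℕ) : ℤ) u ∈ AdmA) ∧
          (∀ u ∈ selmerGroup (cubeSumCurve (p : ℚ)) ((2 ^ κ * 2 ^ κ : ℕ) : ℤ), resTorsion (cubeSumCurve (p : ℚ)) K ((2 ^ κ * 2 ^ κ : ℕ) : ℤ) u ∈ AdmB) ∧
          -- (T-L1) the two FLIPs with multiples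
          (∀ ℓ m, Kol ℓ → KolSupp Kol (ℓ * m) → Even m.primeFactors.card →
            ∀ v : HeightOneSpectrum (𝓞 K), (ℓ : 𝓞 K) ∈ v.asIdeal → ∀ a : ℕ,
            (((2 : ℤ) ^ a) • cA (ℓ * m) ∈ selmerLocalKer ((cubeSumCurve (3 * (p : ℚ) ^ 2)).baseChange K)
                (v.adicCompletion K) ((2 ^ κ * 2 ^ κ : ℕ) : ℤ) ↔
              ((2 : ℤ) ^ a) • cB m ∈ ((cubeSumCurve (p : ℚ)).baseChange K).torsionLocalKer
                (v.adicCompletion K) ((2 ^ κ * 2 ^ κ : ℕ) : ℤ))) ∧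
          (∀ ℓ m, Kol ℓ → KolSupp Kol (ℓ * m) → Odd m.primeFactors.card →
            ∀ v : HeightOneSpectrum (𝓞 K), (ℓ : 𝓞 K) ∈ v.asIdeal → ∀ a : ℕ,
            (((2 : ℤ) ^ a) • cB (ℓ * m) ∈ selmerLocalKer ((cubeSumCurve (p : ℚ)).baseChange K)
                (v.adicCompletion K) ((2 ^ κ * 2 ^ κ : ℕ) : ℤ) ↔
              ((2 : ℤ) ^ a) • cA m ∈ ((cubeSumCurve (3 * (p : ℚ) ^ 2)).baseChange K).torsionLocalKer
                (v.adicCompletion K) ((2 ^ κ * 2 ^ κ : ℕ) : ℤ))) ∧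
          -- (T-L1) Selmer away from `λ` and the places over `m` (McCallum Lemma 4.3)
          (∀ ℓ m : ℕ, Kol ℓ → KolSupp Kol (ℓ * m) → ¬ ℓ ∣ m →
            ∀ v₀ : HeightOneSpectrum (𝓞 K), (ℓ : 𝓞 K) ∈ v₀.asIdeal →
            ∀ v : Place K, v ≠ Sum.inr v₀ →
              (∀ q : HeightOneSpectrum (𝓞 K), (∃ r ∈ m.primeFactors, (r : 𝓞 K) ∈ q.asIdeal) →
                v ≠ Sum.inr q) →
              cA (ℓ * m) ∈ selmerLocalKer ((cubeSumCurve (3 * (p : ℚ) ^ 2)).baseChange K) (Place.Completion v) ((2 ^ κ * 2 ^ κ : ℕ) : ℤ)) ∧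
          (∀ ℓ m : ℕ, Kol ℓ → KolSupp Kol (ℓ * m) → ¬ ℓ ∣ m →
            ∀ v₀ : HeightOneSpectrum (𝓞 K), (ℓ : 𝓞 K) ∈ v₀.asIdeal →
            ∀ v : Place K, v ≠ Sum.inr v₀ →
              (∀ q : HeightOneSpectrum (𝓞 K), (∃ r ∈ m.primeFactors, (r : 𝓞 K) ∈ q.asIdeal) →
                v ≠ Sum.inr q) →
              cB (ℓ * m) ∈ selmerLocalKer ((cubeSumCurve (p : ℚ)).baseChange K) (Place.Completion v) ((2 ^ κ * 2 ^ κ : ℕ) : ℤ)) ∧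
          -- the Kolyvagin primes' level: `X[4^κ] ⊆ X(K_q)`
          (∀ r : ℕ, Kol r → ∀ q : HeightOneSpectrum (𝓞 K), (r : 𝓞 K) ∈ q.asIdeal →
            ∀ (g : absoluteGaloisGroup (Place.Completion (Sum.inr q : Place K)))
              (Q : geomTorsion ((cubeSumCurve (3 * (p : ℚ) ^ 2)).baseChange K) ((2 ^ κ * 2 ^ κ : ℕ) : ℤ)),
              absGaloisRestrict K (Place.Completion (Sum.inr q : Place K)) g • Q = Q) ∧
          (∀ r : ℕ, Kol r → ∀ q : HeightOneSpectrum (𝓞 K), (r : 𝓞 K) ∈ q.asIdeal →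
            ∀ (g : absoluteGaloisGroup (Place.Completion (Sum.inr q : Place K)))
              (Q : geomTorsion ((cubeSumCurve (p : ℚ)).baseChange K) ((2 ^ κ * 2 ^ κ : ℕ) : ℤ)),
              absGaloisRestrict K (Place.Completion (Sum.inr q : Place K)) g • Q = Q) ∧
          -- (T-L2)′ LOCAL LEAVES, 𝒪-LINE form: NOT BOTH local terms (over `t`, over `w_X t`) vanish
          (∀ ℓ m : ℕ, Kol ℓ → KolSupp Kol (ℓ * m) → ¬ ℓ ∣ m → Even m.primeFactors.card →
            ∀ (j N' a b : ℕ) (t : galH1Torsion ((cubeSumCurve (3 * (p : ℚ) ^ 2)).baseChange K) ((2 ^ κ * 2 ^ κ : ℕ) : ℤ))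
              (ht : t ∈ selmerGroup ((cubeSumCurve (3 * (p : ℚ) ^ 2)).baseChange K) ((2 ^ κ * 2 ^ κ : ℕ) : ℤ))
              (hz : ((2 : ℤ) ^ j) • cA (ℓ * m) ∈ selmerGroup ((cubeSumCurve (3 * (p : ℚ) ^ 2)).baseChange K) ((2 ^ κ * 2 ^ κ : ℕ) : ℤ)),
              ((2 : ℤ) ^ N') • t = 0 →
              (∀ q ∈ m.primeFactors, ∀ v : HeightOneSpectrum (𝓞 K), (q : 𝓞 K) ∈ v.asIdeal →
                t ∈ ((cubeSumCurve (3 * (p : ℚ) ^ 2)).baseChange K).torsionLocalKer (v.adicCompletion K) ((2 ^ κ * 2 ^ κ : ℕ) : ℤ)) →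
              κ ≤ j → N' ≤ κ → N' ≤ j → a + b + 1 = N' →
              (∀ v : HeightOneSpectrum (𝓞 K), (ℓ : 𝓞 K) ∈ v.asIdeal →
                ((2 : ℤ) ^ (a + (j - N'))) • cB m ∉
                  ((cubeSumCurve (p : ℚ)).baseChange K).torsionLocalKer (v.adicCompletion K) ((2 ^ κ * 2 ^ κ : ℕ) : ℤ)) →
              (∀ v : HeightOneSpectrum (𝓞 K), (ℓ : 𝓞 K) ∈ v.asIdeal → ((2 : ℤ) ^ b) • t ∉
                ((cubeSumCurve (3 * (p : ℚ) ^ 2)).baseChange K).torsionLocalKer (v.adicCompletion K) ((2 ^ κ * 2 ^ κ : ℕ) : ℤ)) →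
              ∀ v₀ : HeightOneSpectrum (𝓞 K), (ℓ : 𝓞 K) ∈ v₀.asIdeal →
              (∀ D : FirstCaseData ((cubeSumCurve (3 * (p : ℚ) ^ 2)).baseChange K) (2 ^ κ), D.b₁ = ((2 : ℤ) ^ (j - κ)) • cA (ℓ * m) →
                galoisCohomology.map (inclKD ((cubeSumCurve (3 * (p : ℚ) ^ 2)).baseChange K) (2 ^ κ) (2 ^ κ)) 1 D.b' = t →
                D.localTerm eA hμA hadd₁A hadd₂A hgalA
                  (LocalInvariants.canonical K (2 ^ κ * 2 ^ κ)) (Sum.inr v₀) = 0) →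
              (∀ D : FirstCaseData ((cubeSumCurve (3 * (p : ℚ) ^ 2)).baseChange K) (2 ^ κ), D.b₁ = ((2 : ℤ) ^ (j - κ)) • cA (ℓ * m) →
                galoisCohomology.map (inclKD ((cubeSumCurve (3 * (p : ℚ) ^ 2)).baseChange K) (2 ^ κ) (2 ^ κ)) 1 D.b' =
                  resH1Hom (ContinuousMonoidHom.id _) fnA hfnA t →
                D.localTerm eA hμA hadd₁A hadd₂A hgalA
                  (LocalInvariants.canonical K (2 ^ κ * 2 ^ κ)) (Sum.inr v₀) = 0) →
              False) ∧
          (∀ ℓ m : ℕ, Kol ℓ → KolSupp Kol (ℓ * m) → ¬ ℓ ∣ m → Odd m.primeFactors.card →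
            ∀ (j N' a b : ℕ) (t : galH1Torsion ((cubeSumCurve (p : ℚ)).baseChange K) ((2 ^ κ * 2 ^ κ : ℕ) : ℤ))
              (ht : t ∈ selmerGroup ((cubeSumCurve (p : ℚ)).baseChange K) ((2 ^ κ * 2 ^ κ : ℕ) : ℤ))
              (hz : ((2 : ℤ) ^ j) • cB (ℓ * m) ∈ selmerGroup ((cubeSumCurve (p : ℚ)).baseChange K) ((2 ^ κ * 2 ^ κ : ℕ) : ℤ)),
              ((2 : ℤ) ^ N') • t = 0 →
              (∀ q ∈ m.primeFactors, ∀ v : HeightOneSpectrum (𝓞 K), (q : 𝓞 K) ∈ v.asIdeal →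
                t ∈ ((cubeSumCurve (p : ℚ)).baseChange K).torsionLocalKer (v.adicCompletion K) ((2 ^ κ * 2 ^ κ : ℕ) : ℤ)) →
              κ ≤ j → N' ≤ κ → N' ≤ j → a + b + 1 = N' →
              (∀ v : HeightOneSpectrum (𝓞 K), (ℓ : 𝓞 K) ∈ v.asIdeal →
                ((2 : ℤ) ^ (a + (j - N'))) • cA m ∉
                  ((cubeSumCurve (3 * (p : ℚ) ^ 2)).baseChange K).torsionLocalKer (v.adicCompletion K) ((2 ^ κ * 2 ^ κ : ℕ) : ℤ)) →
              (∀ v : HeightOneSpectrum (𝓞 K), (ℓ : 𝓞 K) ∈ v.asIdeal → ((2 : ℤ) ^ b) • t ∉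
                ((cubeSumCurve (p : ℚ)).baseChange K).torsionLocalKer (v.adicCompletion K) ((2 ^ κ * 2 ^ κ : ℕ) : ℤ)) →
              ∀ v₀ : HeightOneSpectrum (𝓞 K), (ℓ : 𝓞 K) ∈ v₀.asIdeal →
              (∀ D : FirstCaseData ((cubeSumCurve (p : ℚ)).baseChange K) (2 ^ κ), D.b₁ = ((2 : ℤ) ^ (j - κ)) • cB (ℓ * m) →
                galoisCohomology.map (inclKD ((cubeSumCurve (p : ℚ)).baseChange K) (2 ^ κ) (2 ^ κ)) 1 D.b' = t →
                D.localTerm eB hμB hadd₁B hadd₂B hgalB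
                  (LocalInvariants.canonical K (2 ^ κ * 2 ^ κ)) (Sum.inr v₀) = 0) →
              (∀ D : FirstCaseData ((cubeSumCurve (p : ℚ)).baseChange K) (2 ^ κ), D.b₁ = ((2 : ℤ) ^ (j - κ)) • cB (ℓ * m) →
                galoisCohomology.map (inclKD ((cubeSumCurve (p : ℚ)).baseChange K) (2 ^ κ) (2 ^ κ)) 1 D.b' =
                  resH1Hom (ContinuousMonoidHom.id _) fnB hfnB t →
                D.localTerm eB hμB hadd₁B hadd₂B hgalB
                  (LocalInvariants.canonical K (2 ^ κ * 2 ^ κ)) (Sum.inr v₀) = 0) →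
              False) ∧
          -- (T-L3) the MIXED Čebotarev clause (memo Cor. 3.2″) for `w_X := resH1Hom id fn_X hfn_X`
          (∀ (TA : Finset (galH1Torsion ((cubeSumCurve (3 * (p : ℚ) ^ 2)).baseChange K) ((2 ^ κ * 2 ^ κ : ℕ) : ℤ)))
            (TB : Finset (galH1Torsion ((cubeSumCurve (p : ℚ)).baseChange K) ((2 ^ κ * 2 ^ κ : ℕ) : ℤ)))
            (gA : galH1Torsion ((cubeSumCurve (3 * (p : ℚ) ^ 2)).baseChange K) ((2 ^ κ * 2 ^ κ : ℕ) : ℤ))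
            (gB : galH1Torsion ((cubeSumCurve (p : ℚ)).baseChange K) ((2 ^ κ * 2 ^ κ : ℕ) : ℤ)),
            gA ∈ AdmA → gB ∈ AdmB → (↑TA : Set _) ⊆ AdmA → (↑TB : Set _) ⊆ AdmB → ∀ b : ℕ,
            ∃ ℓ, b < ℓ ∧ Kol ℓ ∧
            (∀ g ∈ AddSubgroup.closure (insert gA (insert (resH1Hom (ContinuousMonoidHom.id _) fnA hfnA gA)
                ((TA : Set _) ∪ resH1Hom (ContinuousMonoidHom.id _) fnA hfnA '' (TA : Set _)))),
              (∀ v : HeightOneSpectrum (𝓞 K), (ℓ : 𝓞 K) ∈ v.asIdeal →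
                g ∈ ((cubeSumCurve (3 * (p : ℚ) ^ 2)).baseChange K).torsionLocalKer (v.adicCompletion K)
                  ((2 ^ κ * 2 ^ κ : ℕ) : ℤ)) ↔
              g ∈ AddSubgroup.closure ((TA : Set _) ∪ resH1Hom (ContinuousMonoidHom.id _) fnA hfnA '' (TA : Set _))) ∧
            (∀ g ∈ AddSubgroup.closure (insert gB (insert (resH1Hom (ContinuousMonoidHom.id _) fnB hfnB gB)
                ((TB : Set _) ∪ resH1Hom (ContinuousMonoidHom.id _) fnB hfnB '' (TB : Set _)))),
              (∀ v : HeightOneSpectrum (𝓞 K), (ℓ : 𝓞 K) ∈ v.asIdeal →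
                g ∈ ((cubeSumCurve (p : ℚ)).baseChange K).torsionLocalKer (v.adicCompletion K)
                  ((2 ^ κ * 2 ^ κ : ℕ) : ℤ)) ↔
              g ∈ AddSubgroup.closure ((TB : Set _) ∪ resH1Hom (ContinuousMonoidHom.id _) fnB hfnB '' (TB : Set _)))) ∧
          -- the `ℚ`-KUMMER inputs of the lifts (#K11's five, `T := 2κ`) for `A` and for `B`
          yA ∈ selmerGroup (cubeSumCurve (3 * (p : ℚ) ^ 2)) ((2 ^ κ * 2 ^ κ : ℕ) : ℤ) ∧ torsionH1ToH1 (cubeSumCurve (3 * (p : ℚ) ^ 2)) ((2 ^ κ * 2 ^ κ : ℕ) : ℤ) yA = 0 ∧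
          (∀ a : ℤ, a • yA = 0 → ((2 : ℤ) ^ (2 * κ) ∣ a) ∨ yA = 0) ∧
          (∀ u ∈ selmerGroup (cubeSumCurve (3 * (p : ℚ) ^ 2)) ((2 ^ κ * 2 ^ κ : ℕ) : ℤ), torsionH1ToH1 (cubeSumCurve (3 * (p : ℚ) ^ 2)) ((2 ^ κ * 2 ^ κ : ℕ) : ℤ) u = 0 → ∃ a : ℤ, u = a • yA) ∧
          yB ∈ selmerGroup (cubeSumCurve (p : ℚ)) ((2 ^ κ * 2 ^ κ : ℕ) : ℤ) ∧ torsionH1ToH1 (cubeSumCurve (p : ℚ)) ((2 ^ κ * 2 ^ κ : ℕ) : ℤ) yB = 0 ∧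
          (∀ a : ℤ, a • yB = 0 → ((2 : ℤ) ^ (2 * κ) ∣ a) ∨ yB = 0) ∧
          (∀ u ∈ selmerGroup (cubeSumCurve (p : ℚ)) ((2 ^ κ * 2 ^ κ : ℕ) : ℤ), torsionH1ToH1 (cubeSumCurve (p : ℚ)) ((2 ^ κ * 2 ^ κ : ℕ) : ℤ) u = 0 → ∃ a : ℤ, u = a • yB)
    := by
  sorry

set_option maxHeartbeats 1600000 in
/-- **CLOSED IN-FILE — VARIANT N's `stub_tailFour` VERBATIM** from `stub_printInputVII` (clause (vii) = `.2`), the tree's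
`H3_holds` / `LP_holds` (p715484) and `stub_residueFour`, by `SylvesterTwoCoupledTelescope.tailFour_of_residue` (p714972).
No `sorry` here. -/
theorem tailFour_closed : PublishedFactsTwoPlus →
    ∀ (p : ℕ), p.Prime → p % 9 = 4 → (¬ ∃ x : ZMod p, x ^ 3 = 3) →
      ∀ (A B : WeierstrassCurve ℚ) [A.IsElliptic] [A.IsGloballyMinimal] [B.IsElliptic]
        [B.IsGloballyMinimal], (∃ C : VariableChange ℚ, C • B = HuShuYin2019.cubeSumCurve (p : ℚ)) →
        (∃ C : VariableChange ℚ, C • A = HuShuYin2019.cubeSumCurve (3 * (p : ℚ) ^ 2)) →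
        4 < Nat.card (AddCommGroup.primaryComponent B.sha 2) *
            Nat.card (AddCommGroup.primaryComponent A.sha 2) →
        ∃ qB qA : ℚ, shaAn B = (qB : ℂ) ∧ shaAn A = (qA : ℂ) ∧ qB * qA ≠ 0 ∧
          (padicValNat 2 (Nat.card (AddCommGroup.primaryComponent B.sha 2)) : ℤ) +
              (padicValNat 2 (Nat.card (AddCommGroup.primaryComponent A.sha 2)) : ℤ) ≤
            padicValRat 2 (qB * qA) :=
  tailFour_of_residue (fun K _ _ σ₀ h2 hσ₀ ↦ (stub_printInputVII K σ₀ h2 hσ₀).2) H3_holds LP_holds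
    stub_residueFour

set_option maxHeartbeats 1600000 in
/-- **CLOSED — FIRST LAYER, p ≡ 7 (9)** (VARIANT M's `firstLayerSeven_closed` VERBATIM, from `thmC_closed` +
`layerL1Seven_closed` by g22 #22 `firstLayerSeven_of_layerL1`). -/
theorem firstLayerSeven_closed : PublishedFactsTwoPlus →
    ∀ (p : ℕ), p.Prime → p % 9 = 7 → (¬ ∃ x : ZMod p, x ^ 3 = 3) →
      ∀ (A B : WeierstrassCurve ℚ) [A.IsElliptic] [A.IsGloballyMinimal] [B.IsElliptic]
        [B.IsGloballyMinimal], (∃ C : VariableChange ℚ, C • B = HuShuYin2019.cubeSumCurve (p : ℚ)) →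
        (∃ C : VariableChange ℚ, C • A = HuShuYin2019.cubeSumCurve (3 * (p : ℚ) ^ 2)) →
        ∀ (qB qA : ℚ), shaAn B = (qB : ℂ) → shaAn A = (qA : ℂ) → qB * qA ≠ 0 →
          padicValRat 2 (qB * qA) = 0 →
          Nat.card (AddCommGroup.primaryComponent B.sha 2) = 1 ∧
            Nat.card (AddCommGroup.primaryComponent A.sha 2) = 1 :=
  fun hF ↦ firstLayerSeven_of_layerL1 (layerL1Seven_closed (thmC_closed hF)) hF

set_option maxHeartbeats 1600000 in
/-- **stub (row k-p2, p ≡ 7 (9)) — RESIDUE 7 v3: THE ROWS' CONTRACT** (the `hR` binder of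
`SylvesterTwoCoupledTelescope.tailSeven_of_residue` VERBATIM, p714989; the 7-twin of RESIDUE 4 v3). [size XL]
[cite: McCallumLMS1991, §4–§5, Thm. 5.4, Cor. 5.6] [cite: GrossLMS1991, §3–§5] -/
theorem stub_residueSeven :
    PublishedFactsTwoPlus →
    ∀ (p : ℕ), p.Prime → p % 9 = 7 → (¬ ∃ x : ZMod p, x ^ 3 = 3) →
      ∀ (A B : WeierstrassCurve ℚ) [A.IsElliptic] [A.IsGloballyMinimal] [B.IsElliptic]
        [B.IsGloballyMinimal], (∃ C : VariableChange ℚ, C • B = HuShuYin2019.cubeSumCurve (p : ℚ)) →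
        (∃ C : VariableChange ℚ, C • A = HuShuYin2019.cubeSumCurve (3 * (p : ℚ) ^ 2)) →
        4 < Nat.card (AddCommGroup.primaryComponent B.sha 2) *
            Nat.card (AddCommGroup.primaryComponent A.sha 2) →
        ∀ (qB qA : ℚ), shaAn B = (qB : ℂ) → shaAn A = (qA : ℂ) → qB * qA ≠ 0 →
        ∀ (K : Type) [Field K] [NumberField K] (ω : K), ω ^ 2 + ω + 1 = 0 →
          Module.finrank ℚ K = 2 →
        ∀ (CB : VariableChange ℚ) (hCB : CB • B = HuShuYin2019.cubeSumCurve (p : ℚ))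
          (P : B.toAffine.Point) (Y : (B.baseChange K).toAffine.Point),
          ¬ IsOfFinAddOrder (WeierstrassCurve.QuadraticDescent.incl K B P) →
          (∀ Q : B.toAffine.Point, ∃ m : ℤ, IsOfFinAddOrder
            (WeierstrassCurve.QuadraticDescent.incl K B Q -
              m • WeierstrassCurve.QuadraticDescent.incl K B P)) →
          ((qB * qA : ℚ) : ℝ) *
              WeierstrassCurve.Affine.Point.canonicalHeight (WeierstrassCurve.QuadraticDescent.incl K B P) =
            (2 : ℝ) ^ (if p % 9 = 4 then (0 : ℤ) else -2) *
              WeierstrassCurve.Affine.Point.canonicalHeight Y →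
        -- THE RESIDUE: provenance, then for every level `κ ≥ max(M₀, 1)`, every pinned one-φ datum
        -- and every Weil datum, the rows' level-`κ` leaves
        ∃ (M₀ : ℕ) (x₀ T : ((cubeSumCurve (p : ℚ)).baseChange K).toAffine.Point),
        IsOfFinAddOrder T ∧
        Affine.Point.congrEquiv (congrArg (fun W : WeierstrassCurve ℚ ↦ W.baseChange K) hCB)
            (VariableChange.pointEquivBaseChange B CB K Y) = ((2 ^ M₀ : ℕ) : ℤ) • x₀ + T ∧
        2 * (M₀ : ℤ) ≤ padicValRat 2 (qB * qA) ∧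
        ∀ κ : ℕ, M₀ ≤ κ → 1 ≤ κ →
        ∀ (φA : Isogeny ((cubeSumCurve (3 * (p : ℚ) ^ 2)).baseChange K) ((cubeSumCurve (3 * (p : ℚ) ^ 2)).baseChange K))
          (fnA : geomTorsion ((cubeSumCurve (3 * (p : ℚ) ^ 2)).baseChange K) ((2 ^ κ * 2 ^ κ : ℕ) : ℤ) →+ geomTorsion ((cubeSumCurve (3 * (p : ℚ) ^ 2)).baseChange K) ((2 ^ κ * 2 ^ κ : ℕ) : ℤ))
          (hfnA : ∀ (g : absoluteGaloisGroup K) (Q : geomTorsion ((cubeSumCurve (3 * (p : ℚ) ^ 2)).baseChange K) ((2 ^ κ * 2 ^ κ : ℕ) : ℤ)),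
            fnA (ContinuousMonoidHom.id _ g • Q) = g • fnA Q),
          (∀ (x y : AlgebraicClosure K)
            (h : (((cubeSumCurve (3 * (p : ℚ) ^ 2)).baseChange K).baseChange (AlgebraicClosure K)).toAffine.Nonsingular x y),
            ∃ h', φA (Affine.Point.some x y h) =
              Affine.Point.some (algebraMap K (AlgebraicClosure K) ω ^ 2 * x)
                (algebraMap K (AlgebraicClosure K) ω ^ 3 * y) h') →
          (∀ Q : geomTorsion ((cubeSumCurve (3 * (p : ℚ) ^ 2)).baseChange K) ((2 ^ κ * 2 ^ κ : ℕ) : ℤ),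
            ((fnA Q : geomTorsion ((cubeSumCurve (3 * (p : ℚ) ^ 2)).baseChange K) ((2 ^ κ * 2 ^ κ : ℕ) : ℤ)) : geomPoints ((cubeSumCurve (3 * (p : ℚ) ^ 2)).baseChange K)) = φA Q) →
        ∀ (φB : Isogeny ((cubeSumCurve (p : ℚ)).baseChange K) ((cubeSumCurve (p : ℚ)).baseChange K))
          (fnB : geomTorsion ((cubeSumCurve (p : ℚ)).baseChange K) ((2 ^ κ * 2 ^ κ : ℕ) : ℤ) →+ geomTorsion ((cubeSumCurve (p : ℚ)).baseChange K) ((2 ^ κ * 2 ^ κ : ℕ) : ℤ))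
          (hfnB : ∀ (g : absoluteGaloisGroup K) (Q : geomTorsion ((cubeSumCurve (p : ℚ)).baseChange K) ((2 ^ κ * 2 ^ κ : ℕ) : ℤ)),
            fnB (ContinuousMonoidHom.id _ g • Q) = g • fnB Q),
          (∀ (x y : AlgebraicClosure K)
            (h : (((cubeSumCurve (p : ℚ)).baseChange K).baseChange (AlgebraicClosure K)).toAffine.Nonsingular x y),
            ∃ h', φB (Affine.Point.some x y h) =
              Affine.Point.some (algebraMap K (AlgebraicClosure K) ω ^ 2 * x)
                (algebraMap K (AlgebraicClosure K) ω ^ 3 * y) h') →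
          (∀ Q : geomTorsion ((cubeSumCurve (p : ℚ)).baseChange K) ((2 ^ κ * 2 ^ κ : ℕ) : ℤ),
            ((fnB Q : geomTorsion ((cubeSumCurve (p : ℚ)).baseChange K) ((2 ^ κ * 2 ^ κ : ℕ) : ℤ)) : geomPoints ((cubeSumCurve (p : ℚ)).baseChange K)) = φB Q) →
        ∀ (eA : geomTorsion ((cubeSumCurve (3 * (p : ℚ) ^ 2)).baseChange K) ((2 ^ κ * 2 ^ κ : ℕ) : ℤ) → geomTorsion ((cubeSumCurve (3 * (p : ℚ) ^ 2)).baseChange K) ((2 ^ κ * 2 ^ κ : ℕ) : ℤ) → AlgebraicClosure K)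
          (hμA : ∀ S T, eA S T ^ (2 ^ κ * 2 ^ κ) = 1)
          (hadd₁A : ∀ S₁ S₂ T, eA (S₁ + S₂) T = eA S₁ T * eA S₂ T)
          (hadd₂A : ∀ S T₁ T₂, eA S (T₁ + T₂) = eA S T₁ * eA S T₂)
          (hgalA : ∀ (σ : absoluteGaloisGroup K) (S T : geomTorsion ((cubeSumCurve (3 * (p : ℚ) ^ 2)).baseChange K) ((2 ^ κ * 2 ^ κ : ℕ) : ℤ)),
            σ • eA S T = eA (σ • S) (σ • T)),
          (∀ T, eA T T = 1) → (∀ T, (∀ S, eA S T = 1) → T = 0) →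
        ∀ (eB : geomTorsion ((cubeSumCurve (p : ℚ)).baseChange K) ((2 ^ κ * 2 ^ κ : ℕ) : ℤ) → geomTorsion ((cubeSumCurve (p : ℚ)).baseChange K) ((2 ^ κ * 2 ^ κ : ℕ) : ℤ) → AlgebraicClosure K)
          (hμB : ∀ S T, eB S T ^ (2 ^ κ * 2 ^ κ) = 1)
          (hadd₁B : ∀ S₁ S₂ T, eB (S₁ + S₂) T = eB S₁ T * eB S₂ T)
          (hadd₂B : ∀ S T₁ T₂, eB S (T₁ + T₂) = eB S T₁ * eB S T₂)
          (hgalB : ∀ (σ : absoluteGaloisGroup K) (S T : geomTorsion ((cubeSumCurve (p : ℚ)).baseChange K) ((2 ^ κ * 2 ^ κ : ℕ) : ℤ)),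
            σ • eB S T = eB (σ • S) (σ • T)),
          (∀ T, eB T T = 1) → (∀ T, (∀ S, eB S T = 1) → T = 0) →
        ∃ (Kol : ℕ → Prop)
          (AdmA : Set (galH1Torsion ((cubeSumCurve (3 * (p : ℚ) ^ 2)).baseChange K) ((2 ^ κ * 2 ^ κ : ℕ) : ℤ)))
          (AdmB : Set (galH1Torsion ((cubeSumCurve (p : ℚ)).baseChange K) ((2 ^ κ * 2 ^ κ : ℕ) : ℤ)))
          (x : galH1Torsion ((cubeSumCurve (p : ℚ)).baseChange K) ((2 ^ κ * 2 ^ κ : ℕ) : ℤ))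
          (cA : ℕ → galH1Torsion ((cubeSumCurve (3 * (p : ℚ) ^ 2)).baseChange K) ((2 ^ κ * 2 ^ κ : ℕ) : ℤ))
          (cB : ℕ → galH1Torsion ((cubeSumCurve (p : ℚ)).baseChange K) ((2 ^ κ * 2 ^ κ : ℕ) : ℤ))
          (yA : galH1Torsion (cubeSumCurve (3 * (p : ℚ) ^ 2)) ((2 ^ κ * 2 ^ κ : ℕ) : ℤ))
          (yB : galH1Torsion (cubeSumCurve (p : ℚ)) ((2 ^ κ * 2 ^ κ : ℕ) : ℤ)),
          -- the Kolyvagin primes OF THIS LEVEL: rational primes inert in `K`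
          (∀ ℓ, Kol ℓ → ℓ.Prime ∧ (Ideal.span {(ℓ : 𝓞 K)}).IsPrime) ∧
          -- (T-L5) the bottom class `x = δ x₀` of exact order, `c_B 1 = 2^{M₀} x`
          x = kummerMapTorsion ((cubeSumCurve (p : ℚ)).baseChange K) ((2 ^ κ * 2 ^ κ : ℕ) : ℤ)
            (((cubeSumCurve (p : ℚ)).baseChange K).zsmul_geomPoints_surjective_of_charZero
              (Int.natCast_ne_zero.mpr (mul_ne_zero (pow_ne_zero κ two_ne_zero) (pow_ne_zero κ two_ne_zero)))) x₀ ∧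
          ((2 : ℤ) ^ (2 * κ - 1)) • x ≠ 0 ∧ cB 1 = ((2 : ℤ) ^ M₀) • x ∧
          -- admissibility (the rows' ONE set per curve; `0` and the restrictions from `ℚ` belong to it)
          (∀ n, KolSupp Kol n → Odd n.primeFactors.card → cA n ∈ AdmA) ∧
          (∀ n, KolSupp Kol n → Even n.primeFactors.card → cB n ∈ AdmB) ∧
          (0 : galH1Torsion ((cubeSumCurve (3 * (p : ℚ) ^ 2)).baseChange K) ((2 ^ κ * 2 ^ κ : ℕ) : ℤ)) ∈ AdmA ∧ (0 : galH1Torsion ((cubeSumCurve (p : ℚ)).baseChange K) ((2 ^ κ * 2 ^ κ : ℕ) : ℤ)) ∈ AdmB ∧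
          (∀ u ∈ selmerGroup (cubeSumCurve (3 * (p : ℚ) ^ 2)) ((2 ^ κ * 2 ^ κ : ℕ) : ℤ), resTorsion (cubeSumCurve (3 * (p : ℚ) ^ 2)) K ((2 ^ κ * 2 ^ κ : ℕ) : ℤ) u ∈ AdmA) ∧
          (∀ u ∈ selmerGroup (cubeSumCurve (p : ℚ)) ((2 ^ κ * 2 ^ κ : ℕ) : ℤ), resTorsion (cubeSumCurve (p : ℚ)) K ((2 ^ κ * 2 ^ κ : ℕ) : ℤ) u ∈ AdmB) ∧
          -- (T-L1) the two FLIPs with multiples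
          (∀ ℓ m, Kol ℓ → KolSupp Kol (ℓ * m) → Even m.primeFactors.card →
            ∀ v : HeightOneSpectrum (𝓞 K), (ℓ : 𝓞 K) ∈ v.asIdeal → ∀ a : ℕ,
            (((2 : ℤ) ^ a) • cA (ℓ * m) ∈ selmerLocalKer ((cubeSumCurve (3 * (p : ℚ) ^ 2)).baseChange K)
                (v.adicCompletion K) ((2 ^ κ * 2 ^ κ : ℕ) : ℤ) ↔
              ((2 : ℤ) ^ a) • cB m ∈ ((cubeSumCurve (p : ℚ)).baseChange K).torsionLocalKer
                (v.adicCompletion K) ((2 ^ κ * 2 ^ κ : ℕ) : ℤ))) ∧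
          (∀ ℓ m, Kol ℓ → KolSupp Kol (ℓ * m) → Odd m.primeFactors.card →
            ∀ v : HeightOneSpectrum (𝓞 K), (ℓ : 𝓞 K) ∈ v.asIdeal → ∀ a : ℕ,
            (((2 : ℤ) ^ a) • cB (ℓ * m) ∈ selmerLocalKer ((cubeSumCurve (p : ℚ)).baseChange K)
                (v.adicCompletion K) ((2 ^ κ * 2 ^ κ : ℕ) : ℤ) ↔
              ((2 : ℤ) ^ a) • cA m ∈ ((cubeSumCurve (3 * (p : ℚ) ^ 2)).baseChange K).torsionLocalKer
                (v.adicCompletion K) ((2 ^ κ * 2 ^ κ : ℕ) : ℤ))) ∧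
          -- (T-L1) Selmer away from `λ` and the places over `m` (McCallum Lemma 4.3)
          (∀ ℓ m : ℕ, Kol ℓ → KolSupp Kol (ℓ * m) → ¬ ℓ ∣ m →
            ∀ v₀ : HeightOneSpectrum (𝓞 K), (ℓ : 𝓞 K) ∈ v₀.asIdeal →
            ∀ v : Place K, v ≠ Sum.inr v₀ →
              (∀ q : HeightOneSpectrum (𝓞 K), (∃ r ∈ m.primeFactors, (r : 𝓞 K) ∈ q.asIdeal) →
                v ≠ Sum.inr q) →
              cA (ℓ * m) ∈ selmerLocalKer ((cubeSumCurve (3 * (p : ℚ) ^ 2)).baseChange K) (Place.Completion v) ((2 ^ κ * 2 ^ κ : ℕ) : ℤ)) ∧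
          (∀ ℓ m : ℕ, Kol ℓ → KolSupp Kol (ℓ * m) → ¬ ℓ ∣ m →
            ∀ v₀ : HeightOneSpectrum (𝓞 K), (ℓ : 𝓞 K) ∈ v₀.asIdeal →
            ∀ v : Place K, v ≠ Sum.inr v₀ →
              (∀ q : HeightOneSpectrum (𝓞 K), (∃ r ∈ m.primeFactors, (r : 𝓞 K) ∈ q.asIdeal) →
                v ≠ Sum.inr q) →
              cB (ℓ * m) ∈ selmerLocalKer ((cubeSumCurve (p : ℚ)).baseChange K) (Place.Completion v) ((2 ^ κ * 2 ^ κ : ℕ) : ℤ)) ∧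
          -- the Kolyvagin primes' level: `X[4^κ] ⊆ X(K_q)`
          (∀ r : ℕ, Kol r → ∀ q : HeightOneSpectrum (𝓞 K), (r : 𝓞 K) ∈ q.asIdeal →
            ∀ (g : absoluteGaloisGroup (Place.Completion (Sum.inr q : Place K)))
              (Q : geomTorsion ((cubeSumCurve (3 * (p : ℚ) ^ 2)).baseChange K) ((2 ^ κ * 2 ^ κ : ℕ) : ℤ)),
              absGaloisRestrict K (Place.Completion (Sum.inr q : Place K)) g • Q = Q) ∧
          (∀ r : ℕ, Kol r → ∀ q : HeightOneSpectrum (𝓞 K), (r : 𝓞 K) ∈ q.asIdeal →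
            ∀ (g : absoluteGaloisGroup (Place.Completion (Sum.inr q : Place K)))
              (Q : geomTorsion ((cubeSumCurve (p : ℚ)).baseChange K) ((2 ^ κ * 2 ^ κ : ℕ) : ℤ)),
              absGaloisRestrict K (Place.Completion (Sum.inr q : Place K)) g • Q = Q) ∧
          -- (T-L2)′ LOCAL LEAVES, 𝒪-LINE form: NOT BOTH local terms (over `t`, over `w_X t`) vanish
          (∀ ℓ m : ℕ, Kol ℓ → KolSupp Kol (ℓ * m) → ¬ ℓ ∣ m → Even m.primeFactors.card →
            ∀ (j N' a b : ℕ) (t : galH1Torsion ((cubeSumCurve (3 * (p : ℚ) ^ 2)).baseChange K) ((2 ^ κ * 2 ^ κ : ℕ) : ℤ))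
              (ht : t ∈ selmerGroup ((cubeSumCurve (3 * (p : ℚ) ^ 2)).baseChange K) ((2 ^ κ * 2 ^ κ : ℕ) : ℤ))
              (hz : ((2 : ℤ) ^ j) • cA (ℓ * m) ∈ selmerGroup ((cubeSumCurve (3 * (p : ℚ) ^ 2)).baseChange K) ((2 ^ κ * 2 ^ κ : ℕ) : ℤ)),
              ((2 : ℤ) ^ N') • t = 0 →
              (∀ q ∈ m.primeFactors, ∀ v : HeightOneSpectrum (𝓞 K), (q : 𝓞 K) ∈ v.asIdeal →
                t ∈ ((cubeSumCurve (3 * (p : ℚ) ^ 2)).baseChange K).torsionLocalKer (v.adicCompletion K) ((2 ^ κ * 2 ^ κ : ℕ) : ℤ)) →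
              κ ≤ j → N' ≤ κ → N' ≤ j → a + b + 1 = N' →
              (∀ v : HeightOneSpectrum (𝓞 K), (ℓ : 𝓞 K) ∈ v.asIdeal →
                ((2 : ℤ) ^ (a + (j - N'))) • cB m ∉
                  ((cubeSumCurve (p : ℚ)).baseChange K).torsionLocalKer (v.adicCompletion K) ((2 ^ κ * 2 ^ κ : ℕ) : ℤ)) →
              (∀ v : HeightOneSpectrum (𝓞 K), (ℓ : 𝓞 K) ∈ v.asIdeal → ((2 : ℤ) ^ b) • t ∉
                ((cubeSumCurve (3 * (p : ℚ) ^ 2)).baseChange K).torsionLocalKer (v.adicCompletion K) ((2 ^ κ * 2 ^ κ : ℕ) : ℤ)) →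
              ∀ v₀ : HeightOneSpectrum (𝓞 K), (ℓ : 𝓞 K) ∈ v₀.asIdeal →
              (∀ D : FirstCaseData ((cubeSumCurve (3 * (p : ℚ) ^ 2)).baseChange K) (2 ^ κ), D.b₁ = ((2 : ℤ) ^ (j - κ)) • cA (ℓ * m) →
                galoisCohomology.map (inclKD ((cubeSumCurve (3 * (p : ℚ) ^ 2)).baseChange K) (2 ^ κ) (2 ^ κ)) 1 D.b' = t →
                D.localTerm eA hμA hadd₁A hadd₂A hgalA
                  (LocalInvariants.canonical K (2 ^ κ * 2 ^ κ)) (Sum.inr v₀) = 0) →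
              (∀ D : FirstCaseData ((cubeSumCurve (3 * (p : ℚ) ^ 2)).baseChange K) (2 ^ κ), D.b₁ = ((2 : ℤ) ^ (j - κ)) • cA (ℓ * m) →
                galoisCohomology.map (inclKD ((cubeSumCurve (3 * (p : ℚ) ^ 2)).baseChange K) (2 ^ κ) (2 ^ κ)) 1 D.b' =
                  resH1Hom (ContinuousMonoidHom.id _) fnA hfnA t →
                D.localTerm eA hμA hadd₁A hadd₂A hgalA
                  (LocalInvariants.canonical K (2 ^ κ * 2 ^ κ)) (Sum.inr v₀) = 0) →
              False) ∧
          (∀ ℓ m : ℕ, Kol ℓ → KolSupp Kol (ℓ * m) → ¬ ℓ ∣ m → Odd m.primeFactors.card →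
            ∀ (j N' a b : ℕ) (t : galH1Torsion ((cubeSumCurve (p : ℚ)).baseChange K) ((2 ^ κ * 2 ^ κ : ℕ) : ℤ))
              (ht : t ∈ selmerGroup ((cubeSumCurve (p : ℚ)).baseChange K) ((2 ^ κ * 2 ^ κ : ℕ) : ℤ))
              (hz : ((2 : ℤ) ^ j) • cB (ℓ * m) ∈ selmerGroup ((cubeSumCurve (p : ℚ)).baseChange K) ((2 ^ κ * 2 ^ κ : ℕ) : ℤ)),
              ((2 : ℤ) ^ N') • t = 0 →
              (∀ q ∈ m.primeFactors, ∀ v : HeightOneSpectrum (𝓞 K), (q : 𝓞 K) ∈ v.asIdeal →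
                t ∈ ((cubeSumCurve (p : ℚ)).baseChange K).torsionLocalKer (v.adicCompletion K) ((2 ^ κ * 2 ^ κ : ℕ) : ℤ)) →
              κ ≤ j → N' ≤ κ → N' ≤ j → a + b + 1 = N' →
              (∀ v : HeightOneSpectrum (𝓞 K), (ℓ : 𝓞 K) ∈ v.asIdeal →
                ((2 : ℤ) ^ (a + (j - N'))) • cA m ∉
                  ((cubeSumCurve (3 * (p : ℚ) ^ 2)).baseChange K).torsionLocalKer (v.adicCompletion K) ((2 ^ κ * 2 ^ κ : ℕ) : ℤ)) →
              (∀ v : HeightOneSpectrum (𝓞 K), (ℓ : 𝓞 K) ∈ v.asIdeal → ((2 : ℤ) ^ b) • t ∉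
                ((cubeSumCurve (p : ℚ)).baseChange K).torsionLocalKer (v.adicCompletion K) ((2 ^ κ * 2 ^ κ : ℕ) : ℤ)) →
              ∀ v₀ : HeightOneSpectrum (𝓞 K), (ℓ : 𝓞 K) ∈ v₀.asIdeal →
              (∀ D : FirstCaseData ((cubeSumCurve (p : ℚ)).baseChange K) (2 ^ κ), D.b₁ = ((2 : ℤ) ^ (j - κ)) • cB (ℓ * m) →
                galoisCohomology.map (inclKD ((cubeSumCurve (p : ℚ)).baseChange K) (2 ^ κ) (2 ^ κ)) 1 D.b' = t →
                D.localTerm eB hμB hadd₁B hadd₂B hgalB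
                  (LocalInvariants.canonical K (2 ^ κ * 2 ^ κ)) (Sum.inr v₀) = 0) →
              (∀ D : FirstCaseData ((cubeSumCurve (p : ℚ)).baseChange K) (2 ^ κ), D.b₁ = ((2 : ℤ) ^ (j - κ)) • cB (ℓ * m) →
                galoisCohomology.map (inclKD ((cubeSumCurve (p : ℚ)).baseChange K) (2 ^ κ) (2 ^ κ)) 1 D.b' =
                  resH1Hom (ContinuousMonoidHom.id _) fnB hfnB t →
                D.localTerm eB hμB hadd₁B hadd₂B hgalB
                  (LocalInvariants.canonical K (2 ^ κ * 2 ^ κ)) (Sum.inr v₀) = 0) →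
              False) ∧
          -- (T-L3) the MIXED Čebotarev clause (memo Cor. 3.2″) for `w_X := resH1Hom id fn_X hfn_X`
          (∀ (TA : Finset (galH1Torsion ((cubeSumCurve (3 * (p : ℚ) ^ 2)).baseChange K) ((2 ^ κ * 2 ^ κ : ℕ) : ℤ)))
            (TB : Finset (galH1Torsion ((cubeSumCurve (p : ℚ)).baseChange K) ((2 ^ κ * 2 ^ κ : ℕ) : ℤ)))
            (gA : galH1Torsion ((cubeSumCurve (3 * (p : ℚ) ^ 2)).baseChange K) ((2 ^ κ * 2 ^ κ : ℕ) : ℤ))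
            (gB : galH1Torsion ((cubeSumCurve (p : ℚ)).baseChange K) ((2 ^ κ * 2 ^ κ : ℕ) : ℤ)),
            gA ∈ AdmA → gB ∈ AdmB → (↑TA : Set _) ⊆ AdmA → (↑TB : Set _) ⊆ AdmB → ∀ b : ℕ,
            ∃ ℓ, b < ℓ ∧ Kol ℓ ∧
            (∀ g ∈ AddSubgroup.closure (insert gA (insert (resH1Hom (ContinuousMonoidHom.id _) fnA hfnA gA)
                ((TA : Set _) ∪ resH1Hom (ContinuousMonoidHom.id _) fnA hfnA '' (TA : Set _)))),
              (∀ v : HeightOneSpectrum (𝓞 K), (ℓ : 𝓞 K) ∈ v.asIdeal →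
                g ∈ ((cubeSumCurve (3 * (p : ℚ) ^ 2)).baseChange K).torsionLocalKer (v.adicCompletion K)
                  ((2 ^ κ * 2 ^ κ : ℕ) : ℤ)) ↔
              g ∈ AddSubgroup.closure ((TA : Set _) ∪ resH1Hom (ContinuousMonoidHom.id _) fnA hfnA '' (TA : Set _))) ∧
            (∀ g ∈ AddSubgroup.closure (insert gB (insert (resH1Hom (ContinuousMonoidHom.id _) fnB hfnB gB)
                ((TB : Set _) ∪ resH1Hom (ContinuousMonoidHom.id _) fnB hfnB '' (TB : Set _)))),
              (∀ v : HeightOneSpectrum (𝓞 K), (ℓ : 𝓞 K) ∈ v.asIdeal →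
                g ∈ ((cubeSumCurve (p : ℚ)).baseChange K).torsionLocalKer (v.adicCompletion K)
                  ((2 ^ κ * 2 ^ κ : ℕ) : ℤ)) ↔
              g ∈ AddSubgroup.closure ((TB : Set _) ∪ resH1Hom (ContinuousMonoidHom.id _) fnB hfnB '' (TB : Set _)))) ∧
          -- the `ℚ`-KUMMER inputs of the lifts (#K11's five, `T := 2κ`) for `A` and for `B`
          yA ∈ selmerGroup (cubeSumCurve (3 * (p : ℚ) ^ 2)) ((2 ^ κ * 2 ^ κ : ℕ) : ℤ) ∧ torsionH1ToH1 (cubeSumCurve (3 * (p : ℚ) ^ 2)) ((2 ^ κ * 2 ^ κ : ℕ) : ℤ) yA = 0 ∧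
          (∀ a : ℤ, a • yA = 0 → ((2 : ℤ) ^ (2 * κ) ∣ a) ∨ yA = 0) ∧
          (∀ u ∈ selmerGroup (cubeSumCurve (3 * (p : ℚ) ^ 2)) ((2 ^ κ * 2 ^ κ : ℕ) : ℤ), torsionH1ToH1 (cubeSumCurve (3 * (p : ℚ) ^ 2)) ((2 ^ κ * 2 ^ κ : ℕ) : ℤ) u = 0 → ∃ a : ℤ, u = a • yA) ∧
          yB ∈ selmerGroup (cubeSumCurve (p : ℚ)) ((2 ^ κ * 2 ^ κ : ℕ) : ℤ) ∧ torsionH1ToH1 (cubeSumCurve (p : ℚ)) ((2 ^ κ * 2 ^ κ : ℕ) : ℤ) yB = 0 ∧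
          (∀ a : ℤ, a • yB = 0 → ((2 : ℤ) ^ (2 * κ) ∣ a) ∨ yB = 0) ∧
          (∀ u ∈ selmerGroup (cubeSumCurve (p : ℚ)) ((2 ^ κ * 2 ^ κ : ℕ) : ℤ), torsionH1ToH1 (cubeSumCurve (p : ℚ)) ((2 ^ κ * 2 ^ κ : ℕ) : ℤ) u = 0 → ∃ a : ℤ, u = a • yB)
    := by
  sorry

set_option maxHeartbeats 1600000 in
/-- **CLOSED IN-FILE — VARIANT N's `stub_tailSeven` VERBATIM** from `stub_printInputVII`, `H3_holds` / `LP_holds` and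
`stub_residueSeven`, by `SylvesterTwoCoupledTelescope.tailSeven_of_residue` (p714989). No `sorry` here. -/
theorem tailSeven_closed : PublishedFactsTwoPlus →
    ∀ (p : ℕ), p.Prime → p % 9 = 7 → (¬ ∃ x : ZMod p, x ^ 3 = 3) →
      ∀ (A B : WeierstrassCurve ℚ) [A.IsElliptic] [A.IsGloballyMinimal] [B.IsElliptic]
        [B.IsGloballyMinimal], (∃ C : VariableChange ℚ, C • B = HuShuYin2019.cubeSumCurve (p : ℚ)) →
        (∃ C : VariableChange ℚ, C • A = HuShuYin2019.cubeSumCurve (3 * (p : ℚ) ^ 2)) →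
        4 < Nat.card (AddCommGroup.primaryComponent B.sha 2) *
            Nat.card (AddCommGroup.primaryComponent A.sha 2) →
        ∃ qB qA : ℚ, shaAn B = (qB : ℂ) ∧ shaAn A = (qA : ℂ) ∧ qB * qA ≠ 0 ∧
          (padicValNat 2 (Nat.card (AddCommGroup.primaryComponent B.sha 2)) : ℤ) +
              (padicValNat 2 (Nat.card (AddCommGroup.primaryComponent A.sha 2)) : ℤ) ≤
            padicValRat 2 (qB * qA) :=
  tailSeven_of_residue (fun K _ _ σ₀ h2 hσ₀ ↦ (stub_printInputVII K σ₀ h2 hσ₀).2) H3_holds LP_holds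
    stub_residueSeven

/-- **Composition (kernel-checked)**: the crux BY NAME — VARIANT N's composition with `tailFour_closed` /
`tailSeven_closed` in place of the old TAIL stubs (p590593 `coupledUpperBoundFour_of_firstLayer_of_tail` /
`coupledUpperBoundSeven_of_thmC_of_firstLayer_of_tail`, K3R-7 `upperOffV0HSYPlus_of_coupledUpperBounds`). -/
theorem UpperOffV0HSYPlus_of :
    Summit.BirchSwinnertonDyer.BirchSwinnertonDyer.Theses.SylvesterTwoHeegnerIndex.UpperOffV0HSYPlus :=
  fun hF =>
    upperOffV0HSYPlus_of_coupledUpperBounds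
      (coupledUpperBoundFour_of_firstLayer_of_tail hF (firstLayerFour_closed hF) (tailFour_closed hF))
      (coupledUpperBoundSeven_of_thmC_of_firstLayer_of_tail hF (firstLayerSeven_closed hF) (tailSeven_closed hF)
        (thmC_closed hF)) hF

end Summit.BirchSwinnertonDyer.BirchSwinnertonDyer.Cruxes.UpperOffV0HSYPlus.CoupledVariantO
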